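import Mathlib
import Summits.MatrixMultiplication.MatrixMultiplication.Theses.FidelityWitnesses
import Summits.MatrixMultiplication.MatrixMultiplication.Theorems.FidelityWitnessesDiagonalPowerDecayStubVertexRankLaw
import Summits.MatrixMultiplication.MatrixMultiplication.Theorems.FidelityWitnessesDiagonalPowerDecayBoxPattern
import Summits.MatrixMultiplication.MatrixMultiplication.Theorems.FidelityWitnessesDiagonalPowerDecayGlue
import Literature.Computability.AlgebraicComplexity.PartialMatrixMultiplication
import Literature.Computability.AlgebraicComplexity.TensorRestrictionRank

/-!
# `ProjectorRankDecay` is NECESSARY for the crux and SUMMIT-HARD: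
# `DiagonalPowerDecay ⟹ ProjectorRankDecay ⟹ ω(ℂ) > 2`

Line `vertex-flattening-factor-rank` for the crux `FidelityWitnesses.DiagonalPowerDecay`
(`stmt-MatrixMultiplication-14053`), lead c2.  The planner's skeleton
(`Cruxes/DiagonalPowerDecay/Lines/vertex_flattening_factor_rank.lean`, rev 1) isolated as its hardest stub

  `stub_projectorRankDecay : ∃ C>0 δ>0 ∀ n X, Xᴴ = X → X² = X → R(♯X) ≤ n² → rank X ≤ C·n^{3−2δ}`

(`♯X (a,b,c) = X (a.1,b.2,c.2) (b.1,c.1,a.2)`, the vertex un-flattening: `♯1 = ⟨n,n,n⟩`).  This file certifies its status: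

* `projectorRankDecay_of_diagonalPowerDecay` — the crux IMPLIES it (apply the crux to `S := ♯X`; by the landed dictionary
  `vrl_capture_eq_trace` / `vrl_normSq_eq` this reads `|tr X|² ≤ C n^{3−2δ} ‖X‖_F²`, and for a Hermitian idempotent
  `tr X = ‖X‖_F² = rank X` (`prd_trace_eq_rank`, `prd_normSq_eq_rank`), so `rank X ≤ C n^{3−2δ}`): the stub is a NECESSARY
  waypoint of every proof of the crux;
* `two_lt_omega_of_projectorRankDecay` — it IMPLIES `ω(ℂ) > 2` (at the BOX projectors `D_m = diag 1_{[m]³}` one has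
  `♯D_m =` the zero-padded `⟨m,m,m⟩` = the partial matrix multiplication `⟨n,n,n⟩_{□_m,□_m}` (`prd_unflat_boxDiagonal`), of rank
  `≤ R(⟨m,m,m⟩)` (`tensorRank_partialMatMulTensor_box_le_complex`), and `rank D_m = m³`; so the stub gives the BOX BOUND
  `R(⟨m,m,m⟩) ≤ n² ⟹ m³ ≤ C n^{3−2δ}`, which forces `ω(ℂ) > 2` exactly as in the landed glue `dpdGlue_two_lt_omega`
  (`two_lt_omega_of_boxBound`, reusing `dpdGlue_real_ineq`)); hence `MatrixMultiplication → ¬ProjectorRankDecay`: the stub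
  cannot be proved without proving `ω(ℂ) > 2` (the route target FidelityThesis, by SummitEquivalence).

So `DiagonalPowerDecay ⟹ ProjectorRankDecay ⟹ FidelityThesis`, with `DiagonalPowerDecay ⟹ FidelityThesis` already landed
(`diagonalPowerDecayGlue_proof`): the planner's stub 3 sits exactly between crux and target.
Mathlib + landed Theorems (`vrl_*`, `dpdGlue_real_ineq`, BoxPattern) + Literature (`partialMatMulTensor`,
`exists_tensorRank_matMulTensor_le_rpow`) only; no new definitions (the box projector is a local `Matrix.diagonal` term).
-/

set_option linter.dupNamespace false

namespace Summit.MatrixMultiplication.MatrixMultiplication.Theorems.DiagonalPowerDecay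

open scoped BigOperators
open Filter
open Literature.Computability.AlgebraicComplexity
open Summit.MatrixMultiplication.MatrixMultiplication.Theses.FidelityWitnesses (DiagonalPowerDecay)

/-! ## Idempotent matrices: `tr X = rank X`; Hermitian idempotents: `‖X‖_F² = rank X` -/

/-- **The trace of an idempotent complex matrix is its rank** (`X² = X`: `X` is the projection onto its range along
its kernel, `LinearMap.IsProj.trace`). [folklore] -/
theorem prd_trace_eq_rank {ι : Type*} [Fintype ι] [DecidableEq ι] (X : Matrix ι ι ℂ) (hX : X * X = X) :
    X.trace = (X.rank : ℂ) := by
  have hid : IsIdempotentElem (Matrix.toLin' X) := by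
    change Matrix.toLin' X * Matrix.toLin' X = Matrix.toLin' X
    rw [Module.End.mul_eq_comp, ← Matrix.toLin'_mul, hX]
  have htr := (LinearMap.IsIdempotentElem.isProj_range _ hid).trace
  rw [Matrix.trace_toLin'_eq] at htr
  rw [htr, Matrix.rank, Matrix.toLin'_apply']

/-- **The Frobenius norm of a Hermitian idempotent is its rank**: `Σ_{r,c} |X r c|² = tr (Xᴴ X) = tr X = rank X`.
[folklore] -/
theorem prd_normSq_eq_rank {ι : Type*} [Fintype ι] [DecidableEq ι] (X : Matrix ι ι ℂ)
    (hH : X.IsHermitian) (hX : X * X = X) :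
    (∑ r, ∑ c, ‖X r c‖ ^ 2) = (X.rank : ℝ) := by
  have h1 : (((∑ r, ∑ c, ‖X r c‖ ^ 2 : ℝ)) : ℂ) = (X.conjTranspose * X).trace := by
    rw [Matrix.trace]
    push_cast
    rw [Finset.sum_comm]
    refine Finset.sum_congr rfl fun c _ => ?_
    rw [Matrix.diag_apply, Matrix.mul_apply]
    refine Finset.sum_congr rfl fun r _ => ?_
    rw [Matrix.conjTranspose_apply, Complex.star_def, Complex.conj_mul']
  have h2 : X.conjTranspose * X = X := by rw [hH.eq, hX]
  rw [h2, prd_trace_eq_rank X hX] at h1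
  exact_mod_cast h1

/-! ## The crux implies `ProjectorRankDecay` -/

/-- **`DiagonalPowerDecay ⟹ ProjectorRankDecay`** (the planner's stub 3 is necessary): apply the crux to `S := ♯X`;
`|⟨♯X,T⟩|² = |tr X|² = (rank X)²` and `‖♯X‖² = ‖X‖_F² = rank X` for a Hermitian idempotent `X`
(`vrl_capture_eq_trace`, `vrl_normSq_eq`, `prd_trace_eq_rank`, `prd_normSq_eq_rank`), so `(rank X)² ≤ C n^{3−2δ} rank X`.
[folklore] -/
theorem projectorRankDecay_of_diagonalPowerDecay (hD : DiagonalPowerDecay) :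
    ∃ C : ℝ, 0 < C ∧ ∃ δ : ℝ, 0 < δ ∧ ∀ n : ℕ,
      ∀ X : Matrix (Fin n × Fin n × Fin n) (Fin n × Fin n × Fin n) ℂ,
        X.IsHermitian → X * X = X →
        tensorRank (fun a b c : Fin n × Fin n => X (a.1, b.2, c.2) (b.1, c.1, a.2)) ≤ n ^ 2 →
          (X.rank : ℝ) ≤ C * (n : ℝ) ^ (3 - 2 * δ) := by
  obtain ⟨C, δ, hδ, hB⟩ := hD
  refine ⟨max C 1, lt_max_of_lt_right one_pos, δ, hδ, fun n X hH hX hr => ?_⟩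
  have key := hB n (fun a b c => X (a.1, b.2, c.2) (b.1, c.1, a.2)) hr
  rw [vrl_capture_eq_trace, vrl_normSq_eq, prd_normSq_eq_rank X hH hX, prd_trace_eq_rank X hX,
    Complex.norm_natCast] at key
  have hn : (0 : ℝ) ≤ (n : ℝ) ^ (3 - 2 * δ) := Real.rpow_nonneg (Nat.cast_nonneg n) _
  rcases Nat.eq_zero_or_pos X.rank with h0 | hpos
  · rw [h0, Nat.cast_zero]
    positivity
  · have hr0 : (0 : ℝ) < X.rank := by exact_mod_cast hpos
    have h1 : (X.rank : ℝ) * X.rank ≤ C * (n : ℝ) ^ (3 - 2 * δ) * X.rank := by rw [← sq]; exact key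
    calc (X.rank : ℝ) ≤ C * (n : ℝ) ^ (3 - 2 * δ) := le_of_mul_le_mul_right h1 hr0
      _ ≤ max C 1 * (n : ℝ) ^ (3 - 2 * δ) := mul_le_mul_of_nonneg_right (le_max_left _ _) hn

/-! ## The box projectors -/

/-- The box projector `D_m = diag 1_{[m]³}` on the vertex space `(Fin n)³` is Hermitian. [folklore] -/
theorem prd_boxDiagonal_isHermitian (n m : ℕ) :
    (Matrix.diagonal fun v : Fin n × Fin n × Fin n =>
      if (v.1 : ℕ) < m ∧ (v.2.1 : ℕ) < m ∧ (v.2.2 : ℕ) < m then (1 : ℂ) else 0).IsHermitian := by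
  rw [Matrix.isHermitian_diagonal_iff]
  intro v
  split_ifs <;> simp

/-- The box projector is idempotent. [folklore] -/
theorem prd_boxDiagonal_mul_self (n m : ℕ) :
    (Matrix.diagonal fun v : Fin n × Fin n × Fin n =>
        if (v.1 : ℕ) < m ∧ (v.2.1 : ℕ) < m ∧ (v.2.2 : ℕ) < m then (1 : ℂ) else 0) *
      (Matrix.diagonal fun v : Fin n × Fin n × Fin n =>
        if (v.1 : ℕ) < m ∧ (v.2.1 : ℕ) < m ∧ (v.2.2 : ℕ) < m then (1 : ℂ) else 0) =
      Matrix.diagonal fun v : Fin n × Fin n × Fin n =>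
        if (v.1 : ℕ) < m ∧ (v.2.1 : ℕ) < m ∧ (v.2.2 : ℕ) < m then (1 : ℂ) else 0 := by
  rw [Matrix.diagonal_mul_diagonal]
  congr 1
  funext v
  split_ifs <;> simp

/-- The box projector has rank `m³` (`m ≤ n`): the number of non-zero diagonal entries (`Matrix.rank_diagonal`) is the
filling of the box pattern (`filling_box`). [folklore] -/
theorem prd_boxDiagonal_rank {n m : ℕ} (h : m ≤ n) :
    (Matrix.diagonal fun v : Fin n × Fin n × Fin n =>
      if (v.1 : ℕ) < m ∧ (v.2.1 : ℕ) < m ∧ (v.2.2 : ℕ) < m then (1 : ℂ) else 0).rank = m ^ 3 := by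
  classical
  rw [Matrix.rank_diagonal, Fintype.card_subtype, ← filling_box h]
  unfold filling
  congr 1
  ext v
  simp only [Finset.mem_filter, Finset.mem_univ, true_and, ne_eq, ite_eq_right_iff, one_ne_zero,
    imp_false, not_not]
  tauto

/-- **`♯D_m` is the box-pattern partial matrix multiplication** `⟨n,n,n⟩_{□_m,□_m}` (the zero-padded `⟨m,m,m⟩`):
`D_m (a.1,b.2,c.2) (b.1,c.1,a.2) = [a.1=b.1 ∧ b.2=c.1 ∧ a.2=c.2] · [b, c ∈ □_m]`. [folklore] -/
theorem prd_unflat_boxDiagonal (n m : ℕ) :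
    (fun a b c : Fin n × Fin n =>
      (Matrix.diagonal fun v : Fin n × Fin n × Fin n =>
        if (v.1 : ℕ) < m ∧ (v.2.1 : ℕ) < m ∧ (v.2.2 : ℕ) < m then (1 : ℂ) else 0)
          (a.1, b.2, c.2) (b.1, c.1, a.2)) =
      partialMatMulTensor ℂ n n n
        (Finset.univ.filter fun p : Fin n × Fin n => (p.1 : ℕ) < m ∧ (p.2 : ℕ) < m)
        (Finset.univ.filter fun p : Fin n × Fin n => (p.1 : ℕ) < m ∧ (p.2 : ℕ) < m) := by
  funext a b c
  unfold partialMatMulTensor matMulTensor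
  simp only [Matrix.diagonal_apply, Prod.mk.injEq, Finset.mem_filter, Finset.mem_univ, true_and]
  by_cases hE : a.1 = b.1 ∧ b.2 = c.1 ∧ c.2 = a.2
  · obtain ⟨h1, h2, h3⟩ := hE
    rw [if_pos ⟨h1, h2, h3⟩]
    by_cases hB : (a.1 : ℕ) < m ∧ (b.2 : ℕ) < m ∧ (c.2 : ℕ) < m
    · rw [if_pos hB, if_pos, if_pos ⟨h1, h2, h3.symm⟩]
      refine ⟨⟨?_, hB.2.1⟩, ?_, ?_⟩
      · rw [← h1]; exact hB.1
      · rw [← h2]; exact hB.2.1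
      · exact hB.2.2
    · rw [if_neg hB]
      by_cases hbox : (((b.1 : ℕ) < m ∧ (b.2 : ℕ) < m) ∧ ((c.1 : ℕ) < m ∧ (c.2 : ℕ) < m))
      · exact absurd ⟨by rw [h1]; exact hbox.1.1, hbox.1.2, hbox.2.2⟩ hB
      · rw [if_neg hbox]
  · rw [if_neg hE]
    by_cases hbox : (((b.1 : ℕ) < m ∧ (b.2 : ℕ) < m) ∧ ((c.1 : ℕ) < m ∧ (c.2 : ℕ) < m))
    · rw [if_pos hbox, if_neg]
      rintro ⟨h1, h2, h3⟩
      exact hE ⟨h1, h2, h3.symm⟩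
    · rw [if_neg hbox]

/-- `R(♯D_m) ≤ R(⟨m,m,m⟩)` for `m ≤ n` (`prd_unflat_boxDiagonal` + `tensorRank_partialMatMulTensor_box_le_complex`).
[folklore] -/
theorem prd_tensorRank_unflat_boxDiagonal_le {n m : ℕ} (h : m ≤ n) :
    tensorRank (fun a b c : Fin n × Fin n =>
      (Matrix.diagonal fun v : Fin n × Fin n × Fin n =>
        if (v.1 : ℕ) < m ∧ (v.2.1 : ℕ) < m ∧ (v.2.2 : ℕ) < m then (1 : ℂ) else 0)
          (a.1, b.2, c.2) (b.1, c.1, a.2)) ≤ tensorRank (matMulTensor ℂ m m m) := by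
  rw [prd_unflat_boxDiagonal]
  exact tensorRank_partialMatMulTensor_box_le_complex h

/-! ## The box bound forces `ω(ℂ) > 2` -/

/-- **A BOX BOUND forces `ω(ℂ) > 2`**: if some `C` and `δ > 0` have `m³ ≤ C·n^{3−2δ}` whenever `m ≤ n` and
`R(⟨m,m,m⟩) ≤ n²`, then `2 < ω(ℂ)` — verbatim the argument of the landed glue `dpdGlue_two_lt_omega`: if `ω ≤ 2` then
`R(⟨a,a,a⟩) ≤ C'·a^{2+1/k}` (`exists_tensorRank_matMulTensor_le_rpow`); with `k > 3/(4δ)`, `m = t^{2k}`, `n = N·t^{2k+1}`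
(`N ≥ C'`) the box fits the budget and the bound gives `t^{2δ(2k+1)−3} ≤ max(C,0)·N^{3−2δ}` for all `t ≥ 1`
(`dpdGlue_real_ineq`), absurd as `t → ∞`. [folklore] -/
theorem two_lt_omega_of_boxBound {C δ : ℝ} (hδ : 0 < δ)
    (hbox : ∀ m n : ℕ, m ≤ n → tensorRank (matMulTensor ℂ m m m) ≤ n ^ 2 →
      ((m : ℝ)) ^ 3 ≤ C * (n : ℝ) ^ (3 - 2 * δ)) :
    2 < omega ℂ := by
  -- adapted from Theorems/FidelityWitnessesDiagonalPowerDecayGlue.lean (dpdGlue_two_lt_omega)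
  by_contra hω
  rw [not_lt] at hω
  obtain ⟨k, hk⟩ := exists_nat_gt (3 / (4 * δ))
  have hkpos : (0 : ℝ) < k := lt_trans (by positivity) hk
  have hγ : 0 < 2 * δ * (2 * (k : ℝ) + 1) - 3 := by
    have := (div_lt_iff₀ (by positivity : (0 : ℝ) < 4 * δ)).1 hk
    nlinarith
  obtain ⟨C', hC', hR⟩ :=
    exists_tensorRank_matMulTensor_le_rpow ℂ (δ := 1 / (k : ℝ)) (one_div_pos.2 hkpos)
  obtain ⟨N, hN1, hNC⟩ : ∃ N : ℕ, 1 ≤ N ∧ C' ≤ N :=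
    ⟨⌈C'⌉₊ + 1, by omega, by push_cast; linarith [Nat.le_ceil C']⟩
  have hN0 : (0 : ℝ) ≤ N := Nat.cast_nonneg N
  have hN1' : (1 : ℝ) ≤ N := by exact_mod_cast hN1
  -- the key inequality, for every `t ≥ 1`
  have key : ∀ t : ℕ, 1 ≤ t →
      (t : ℝ) ^ (2 * δ * (2 * (k : ℝ) + 1) - 3) ≤ max C 0 * (N : ℝ) ^ (3 - 2 * δ) := by
    intro t ht
    have ht0 : (0 : ℝ) < t := by exact_mod_cast ht
    have hm1 : 1 ≤ t ^ (2 * k) := Nat.one_le_pow _ _ ht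
    have hmn : t ^ (2 * k) ≤ N * t ^ (2 * k + 1) :=
      (Nat.pow_le_pow_right ht (Nat.le_succ _)).trans (Nat.le_mul_of_pos_left _ hN1)
    have hrank : tensorRank (matMulTensor ℂ (t ^ (2 * k)) (t ^ (2 * k)) (t ^ (2 * k))) ≤
        (N * t ^ (2 * k + 1)) ^ 2 := by
      have h1 := hR (t ^ (2 * k)) hm1
      have hm1' : (1 : ℝ) ≤ ((t ^ (2 * k) : ℕ) : ℝ) := by exact_mod_cast hm1
      have h2 : ((t ^ (2 * k) : ℕ) : ℝ) ^ (omega ℂ + 1 / (k : ℝ)) ≤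
          ((t ^ (2 * k) : ℕ) : ℝ) ^ ((2 : ℝ) + 1 / (k : ℝ)) :=
        Real.rpow_le_rpow_of_exponent_le hm1' (by linarith)
      have h3 : ((t ^ (2 * k) : ℕ) : ℝ) ^ ((2 : ℝ) + 1 / (k : ℝ)) = (t : ℝ) ^ (4 * k + 2) := by
        push_cast
        rw [← Real.rpow_natCast (t : ℝ) (2 * k), ← Real.rpow_mul ht0.le,
          ← Real.rpow_natCast (t : ℝ) (4 * k + 2)]
        congr 1
        push_cast
        field_simp
        ring
      have h4 : (tensorRank (matMulTensor ℂ (t ^ (2 * k)) (t ^ (2 * k)) (t ^ (2 * k))) : ℝ) ≤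
          (((N * t ^ (2 * k + 1)) ^ 2 : ℕ) : ℝ) :=
        calc (tensorRank (matMulTensor ℂ (t ^ (2 * k)) (t ^ (2 * k)) (t ^ (2 * k))) : ℝ)
            ≤ C' * ((t ^ (2 * k) : ℕ) : ℝ) ^ (omega ℂ + 1 / (k : ℝ)) := h1
          _ ≤ C' * (t : ℝ) ^ (4 * k + 2) := by
              rw [← h3]; exact mul_le_mul_of_nonneg_left h2 hC'.le
          _ ≤ (N : ℝ) * (t : ℝ) ^ (4 * k + 2) := mul_le_mul_of_nonneg_right hNC (by positivity)
          _ ≤ (N : ℝ) ^ 2 * (t : ℝ) ^ (4 * k + 2) :=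
              mul_le_mul_of_nonneg_right (by nlinarith [hN1']) (by positivity)
          _ = (((N * t ^ (2 * k + 1)) ^ 2 : ℕ) : ℝ) := by push_cast; ring
      exact_mod_cast h4
    have hb := hbox (t ^ (2 * k)) (N * t ^ (2 * k + 1)) hmn hrank
    push_cast at hb
    have body : (((t : ℝ) ^ (2 * k)) ^ 3) ^ 2 ≤
        C * ((N : ℝ) * (t : ℝ) ^ (2 * k + 1)) ^ (3 - 2 * δ) * ((t : ℝ) ^ (2 * k)) ^ 3 := by
      rw [sq]
      exact mul_le_mul_of_nonneg_right hb (by positivity)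
    exact dpdGlue_real_ineq ht0 hN0 body
  have hlim := (tendsto_rpow_atTop hγ).comp tendsto_natCast_atTop_atTop
  obtain ⟨t, ht1, ht2⟩ :=
    ((hlim.eventually_gt_atTop (max C 0 * (N : ℝ) ^ (3 - 2 * δ))).and (eventually_ge_atTop 1)).exists
  exact absurd (key t ht2) (not_le.2 ht1)

/-- **`ProjectorRankDecay ⟹ ω(ℂ) > 2`** (the planner's stub 3 is summit-hard): at the box projectors `D_m`
(`rank D_m = m³`, `R(♯D_m) ≤ R(⟨m,m,m⟩)`) the stub is the box bound of `two_lt_omega_of_boxBound`. [folklore] -/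
theorem two_lt_omega_of_projectorRankDecay
    (hP : ∃ C : ℝ, 0 < C ∧ ∃ δ : ℝ, 0 < δ ∧ ∀ n : ℕ,
      ∀ X : Matrix (Fin n × Fin n × Fin n) (Fin n × Fin n × Fin n) ℂ,
        X.IsHermitian → X * X = X →
        tensorRank (fun a b c : Fin n × Fin n => X (a.1, b.2, c.2) (b.1, c.1, a.2)) ≤ n ^ 2 →
          (X.rank : ℝ) ≤ C * (n : ℝ) ^ (3 - 2 * δ)) :
    2 < omega ℂ := by
  obtain ⟨C, -, δ, hδ, hP⟩ := hP
  refine two_lt_omega_of_boxBound (C := C) hδ fun m n hmn hr => ?_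
  have h := hP n _ (prd_boxDiagonal_isHermitian n m) (prd_boxDiagonal_mul_self n m)
    ((prd_tensorRank_unflat_boxDiagonal_le hmn).trans hr)
  rw [prd_boxDiagonal_rank hmn] at h
  exact_mod_cast h

/-- **`ProjectorRankDecay ⟹ ¬MatrixMultiplication`**: the planner's stub 3 already carries the route's conclusion
(`MatrixMultiplication ↔ ω(ℂ) = 2`). [folklore] -/
theorem not_matrixMultiplication_of_projectorRankDecay
    (hP : ∃ C : ℝ, 0 < C ∧ ∃ δ : ℝ, 0 < δ ∧ ∀ n : ℕ,
      ∀ X : Matrix (Fin n × Fin n × Fin n) (Fin n × Fin n × Fin n) ℂ,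
        X.IsHermitian → X * X = X →
        tensorRank (fun a b c : Fin n × Fin n => X (a.1, b.2, c.2) (b.1, c.1, a.2)) ≤ n ^ 2 →
          (X.rank : ℝ) ≤ C * (n : ℝ) ^ (3 - 2 * δ)) :
    ¬ _root_.MatrixMultiplication := by
  rw [_root_.MatrixMultiplication_iff]
  have h := two_lt_omega_of_projectorRankDecay hP
  intro hM
  rw [hM] at h
  exact lt_irrefl _ h

/-- **`ProjectorRankDecay ⟹ FidelityThesis`**: the planner's stub 3 implies the route TARGET (a failure of the target
forces `ω(ℂ) ≤ 2`, `omega_le_two_of_not_fidelityThesis`). Together with `projectorRankDecay_of_diagonalPowerDecay`: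
`crux ⟹ stub 3 ⟹ target`. [folklore] -/
theorem fidelityThesis_of_projectorRankDecay
    (hP : ∃ C : ℝ, 0 < C ∧ ∃ δ : ℝ, 0 < δ ∧ ∀ n : ℕ,
      ∀ X : Matrix (Fin n × Fin n × Fin n) (Fin n × Fin n × Fin n) ℂ,
        X.IsHermitian → X * X = X →
        tensorRank (fun a b c : Fin n × Fin n => X (a.1, b.2, c.2) (b.1, c.1, a.2)) ≤ n ^ 2 →
          (X.rank : ℝ) ≤ C * (n : ℝ) ^ (3 - 2 * δ)) :
    Summit.MatrixMultiplication.MatrixMultiplication.Theses.FidelityWitnesses.FidelityThesis := by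
  by_contra hX
  have h1 := two_lt_omega_of_projectorRankDecay hP
  have h2 := Summit.MatrixMultiplication.MatrixMultiplication.Theorems.omega_le_two_of_not_fidelityThesis hX
  linarith

end Summit.MatrixMultiplication.MatrixMultiplication.Theorems.DiagonalPowerDecay
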